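import Summits.BirchSwinnertonDyer.BirchSwinnertonDyer.Theorems.KimAtThreeDeepUpperTowerLattice
import Summits.BirchSwinnertonDyer.BirchSwinnertonDyer.Theorems.KimAtThreeFineKatoKPortLogSurjective
import HarnessLib

/-!
# Route `KimAtThreeKolyvagin` (W2): the SHARP per-factor lattice bound `p^{v_p(m)+1} · exp*_{d_w}(H¹(L_w, T_pW)) ⊆ 𝒪_w`
# for `p` odd — exponent ONE at every TAME level (`p ∤ m`): the E-side / field-side truth behind `b = 1` of the
# shallow packages (C1ₑₓ¹ᵘ) / (C1ₑₓʷ) (items 20396 · 19599 · 19077; cell `bsd-addord`, seat w2-c4 gen 11)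

HONEST FRAMING. Theorems only (local instances on `ℚ_v` exactly as in w2-c3's `KimAtThreeDeepUpperTowerLattice`);
nothing is closed or booked; BSD is not proved by any of this. CONDITIONAL on ONE Literature cite fact, displayed:
(S5b-tower) `PAdicHodge.exists_smul_range_expStarCoord_tower_iff_trace_log` (`DualExpEllipticTower.lean`).
`--supports` 19077 (helper). Credit: the engine is seat w2-c3 gen 8's `pow_three_mul_expStarOmegaHom_mem_of_facts`
VERBATIM except for the points side, which is run at seat w2-kport gen 5's SHARP radius
(`KPort.exists_ptLog_eq_of_norm_lt_half`: the formal logarithm is onto every closed ball of radius `< 1/2`, so onto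
`p𝒪_w` for `p` odd, ANY ramification, ANY reduction type) instead of x1b's radius `1/4` (`p²𝒪_w`).

WHY. The deep family's displayed lattice binder hLatᵘ was discharged by w2-c3 g8 with the exponent `b₀ = 3`
(`p³ · exp*_w ⊆ 𝒪_w`), which is all the DEEP cruxes need. The SHALLOW off-stratum rows of 19599 / 19077 read the
compatibility at the exponent `b = 1` EXACTLY (support item 20396 / this seat's weighted package (C1ₑₓʷ) of
`KimAtThreeShallowEqDeepOffStratumOfDefinedKatoWeighted`): `3 · exp*_w(H¹(L_w, T₃W)) ⊆ 𝒪_w` at the TAME levels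
(`L_w/ℚ₃` unramified). THIS FILE proves that bound from (S5b-tower): with the sharp radius the chain reads
`p𝒪_w ⊆ log_ω E(L_w)` ⇒ `Tr_{L_w/ℚ_v}(p a · 𝒪_w) ⊆ 𝒪_v` ⇒ (w2-acc3's inverse-different bound
`p^{v_p(m)} 𝒪_w^∨ ⊆ 𝒪_w`) `p^{v_p(m)+1} a ∈ 𝒪_w` — exponent `1` when `p ∤ m`, `2` at the wild levels `p ∥ m`
(where the truth is `p(1 − ζ_p)·a ∈ 𝒪_w`, `𝒪_w^∨ = (1 − ζ_p)⁻¹𝒪_w`; that needs the tame-ramification trace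
lemma, not in the tree — memo HOME/w2c4/W2C4-WEIGHTED-COMPAT-g11.md §3 (W)).
* §1 `exists_point_padicLogPointFiniteExt_eq_of_norm_lt_half` — every `y ∈ L_w` with `‖y‖ < 1/2` (base `p^{1/e}`)
  is `log_ω` of a point of `W ⊗ L_w` (w2-c3's `exists_point_padicLogPointFiniteExt_eq` at kport's radius);
  `exists_point_padicLogPointFiniteExt_eq_prime_mul` — `p` odd: **`p𝒪_w ⊆ log_ω E(L_w)`**.
* §2 **`pow_padicValNat_succ_mul_expStarOmegaHom_mem_of_facts`** (`p` odd): `p^{v_p(m)+1} · exp*_{dw}(z) ∈ 𝒪_{w₀}`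
  for every (RES_w)-compatible line datum over an `hdual`-normalised Néron line, every level `m = cycLevel p 0 r`,
  every place `w₀ ∣ p`; `three_mul_expStarOmegaHom_mem_of_facts_of_not_dvd` — `p = 3`, `3 ∤ m`:
  **`3 · exp*_{dw}(z) ∈ 𝒪_{w₀}`** (the `b = 1` of (C1ₑₓ¹ᵘ) / the tame weight `θ_r = 1` of (C1ₑₓʷ)).
So, with w2-c2 g9's `…KatoParts` pattern, the tame-level half of «(C1ₑₓʷ) ⟸ hKatoV2ᵘ ∧ R-κ ∧ (S5a) ∧ (S5b-tower)»
has its lattice input in the kernel; the wild-level half waits for the trace lemma (W).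

References: [Kato1993LNM1553] Ch. II §1.2.4, Thm. 1.4.1 (3)–(4); [BlochKato1990] §3 Prop. 3.8, Ex. 3.11;
[SilvermanAEC2009] Thm. IV.6.4 (b), Prop. VII.2.2; [CasselsFrohlichANT1967] Ch. II §10 (10.2); [SerreLocalFields1979]
III §3, §6 (different of a tamely ramified extension); [Kim2022StructureSelmer] §3.4.1 (the consumer's context).
-/

set_option autoImplicit false
-- the Theorems namespace of a single-conjunct summit repeats the summit name by design (D-0017)
set_option linter.dupNamespace false

noncomputable section

open scoped NumberField NNReal Classical
open Field ValuativeRel IsDedekindDomain NumberField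
open Literature.NumberTheory.GaloisRepresentations
open Literature.NumberTheory.GaloisRepresentations.PeriodRingData
open Literature.NumberTheory.PAdicHodge
open Literature.NumberTheory.EllipticCurves WeierstrassCurve
open Literature.NumberTheory.EllipticCurves.FormalGroupChart (padicLogPointFiniteExt)
open Literature.NumberTheory.EllipticCurves.Kato2004.EulerSystemValues (cycLevel)
open Literature.NumberTheory.AdelicBaseChange
open Summit.BirchSwinnertonDyer.BirchSwinnertonDyer.Theorems.KimAtThreeDeepLowerExpStarOmega
open Summit.BirchSwinnertonDyer.BirchSwinnertonDyer.Theorems.KimAtThreeDeepLowerExpStarOmegaPlace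
open Summit.BirchSwinnertonDyer.BirchSwinnertonDyer.Theorems.KimAtThreeDeepUpperExpStarTowerRange
open Summit.BirchSwinnertonDyer.BirchSwinnertonDyer.Theorems.KimAtThreeDeepUpperExpStarUnit
open Summit.BirchSwinnertonDyer.BirchSwinnertonDyer.Theorems.KimAtThreeDeepUpperFactorFieldNorm
open Summit.BirchSwinnertonDyer.BirchSwinnertonDyer.Theorems.KimAtThreeDeepUpperTowerLattice
open Summit.BirchSwinnertonDyer.BirchSwinnertonDyer.Theorems.KimAtThreeSemiLocalTraceDualLocal
open Summit.BirchSwinnertonDyer.BirchSwinnertonDyer.Theorems.KimAtThreePortSharedSATCore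
  (exists_padicInt_coe_eq_of_norm_le_one)
open Summit.BirchSwinnertonDyer.BirchSwinnertonDyer.Theorems.KimAtThreeFineKatoPerFactorPlaces
  (three_mem_asIdeal_extension)
open Summit.BirchSwinnertonDyer.BirchSwinnertonDyer.Theorems.KPort
open Summit.BirchSwinnertonDyer.Rank1Residual.GaloisImage
open Summit.BirchSwinnertonDyer.Rank1Residual.GaloisImage.TameLevel (squarefree_cycLevel_zero)
open Summit.BirchSwinnertonDyer.Rank1Residual.Additive.LocalLog (padicLog)
open Summit.BirchSwinnertonDyer.Rank1Residual.Additive Summit.BirchSwinnertonDyer.Rank1Residual.Additive.BallEval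
open Literature.NumberTheory.EllipticCurves.Rank1Residual
open Literature.NumberTheory.EllipticCurves.FormalGroupChart
open Rat.HeightOneSpectrum

namespace Summit.BirchSwinnertonDyer.BirchSwinnertonDyer.Theorems.KimAtThreeShallowEqDeepSharpLattice

/-! ### §1 The points side at kport's sharp radius: `p𝒪_w ⊆ log_ω E(L_w)` for `p` odd -/

section Points

variable {p : ℕ} [hp : Fact p.Prime] {L : Type} [Field L] [NumberField L]
  {w : ((primesEquiv (R := 𝓞 ℚ)).symm ⟨p, hp.out⟩).Extension (𝓞 L)}
-- instance-POLYMORPHIC in the `ℚ`-algebra structure of `L_w` (as in `KimAtThreeDeepUpperFactorFieldNorm` §Points)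
variable [Algebra ℚ (w.1.adicCompletion L)] (W : WeierstrassCurve ℚ) [W.IsGloballyMinimal]

/-- **Every `y ∈ L_w` with `‖y‖ < 1/2` (norm of base `p^{1/e}`) is `log_ω` of a point of `W ⊗ L_w`**, for every
compatible `ν` making the model integral and EVERY place `w ∣ p`: w2-c3's `exists_point_padicLogPointFiniteExt_eq`
with x1b's radius-`1/4` surjectivity replaced by kport gen 5's `KPort.exists_ptLog_eq_of_norm_lt_half` (successive
approximation with contraction factor `2‖y‖ < 1`), read through kport's junction ((J4a)/(J4b)).
[cite: SilvermanAEC2009, Thm. IV.6.4 with Prop. VII.2.2] -/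
theorem exists_point_padicLogPointFiniteExt_eq_of_norm_lt_half [W.IsElliptic] (ν : Valuation (w.1.adicCompletion L) ℝ≥0)
    [ν.Compatible] [hν : (W.baseChange (w.1.adicCompletion L)).IsIntegral ν.integer]
    (y : Kwe p L w) (hy : ‖y‖ < 1 / 2) :
    ∃ P' : (W.baseChange (w.1.adicCompletion L)).toAffine.Point,
      padicLogPointFiniteExt ν (W.baseChange (w.1.adicCompletion L)) p P' = Kwe.toCompletion p L w y := by
  set M : WeierstrassCurve ℤ_[p] := (integralModelInt W).map (Int.castRingHom ℤ_[p]) with hM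
  haveI hE : (M.map PadicInt.Coe.ringHom).IsElliptic := isElliptic_map_coe_integralModelInt W p
  haveI hint : (curveK p (Kwe p L w) M).IsIntegral (NormedField.valuation (K := Kwe p L w)).integer :=
    isIntegral_curveK p (Kwe p L w) M
  obtain ⟨P, hP, hlog, -⟩ := exists_ptLog_eq_of_norm_lt_half (p := p) (K := Kwe p L w) (M := M) hy
  have hsat : satLog p (Kwe p L w) M P = y := by rw [satLog_of_mem hP, hlog]
  have hC := curveK_integralModelInt_eq_baseChange (p := p) (L := L) (w := w) W
  have hequiv := Kwe.valuation_isEquiv_of_compatible (p := p) (L := L) (w := w) ν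
  haveI hν₁ : (curveK p (Kwe p L w) M).IsIntegral (ν.comap (Kwe.toCompletion p L w).toRingHom).integer :=
    isIntegral_of_isEquiv hequiv _
  haveI hν₂ := isIntegral_comap_toCompletion (p := p) ν (W.baseChange (w.1.adicCompletion L))
  obtain ⟨P', hP'⟩ := Kw.exists_point_padicLogPointFiniteExt_eq_of_eq (ν.comap (Kwe.toCompletion p L w).toRingHom) hC p P
  refine ⟨P', ?_⟩
  rw [← padicLogPointFiniteExt_comap_toCompletion (p := p) ν (W.baseChange (w.1.adicCompletion L)) p P', hP',
    Kwe.toCompletion_apply, ← hsat, satLog_eq_padicLogPointFiniteExt, padicLogPointFiniteExt_apply_eq_of_isEquiv hequiv p P]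

/-- **`p` odd: every element of `p 𝒪_w` is `log_ω` of a point of `W ⊗ L_w`** (`‖p o‖ ≤ ‖p‖ = p⁻¹ ≤ 1/3 < 1/2`), for
every compatible `ν` making the model integral and every place `w ∣ p`, ANY ramification, ANY reduction type —
Silverman's `log : Ê(𝓜ʳ) ⥲ 𝓜ʳ` at `r = v(p) > v(p)/(p − 1)`. [cite: SilvermanAEC2009, Thm. IV.6.4 (b) with Prop. VII.2.2] -/
theorem exists_point_padicLogPointFiniteExt_eq_prime_mul (hp2 : p ≠ 2) [W.IsElliptic]
    (ν : Valuation (w.1.adicCompletion L) ℝ≥0) [ν.Compatible]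
    [hν : (W.baseChange (w.1.adicCompletion L)).IsIntegral ν.integer]
    (o : w.1.adicCompletion L) (ho : o ∈ w.1.adicCompletionIntegers L) :
    ∃ P' : (W.baseChange (w.1.adicCompletion L)).toAffine.Point,
      padicLogPointFiniteExt ν (W.baseChange (w.1.adicCompletion L)) p P' = (p : w.1.adicCompletion L) * o := by
  have hy : ‖((p : ℕ) : Kwe p L w) * (Kwe.toCompletion p L w).symm o‖ < 1 / 2 := by
    have ho' : ‖(Kwe.toCompletion p L w).symm o‖ ≤ 1 :=
      (Kwe.norm_le_one_iff_mem_adicCompletionIntegers _).mpr ho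
    rw [norm_mul]
    calc ‖((p : ℕ) : Kwe p L w)‖ * ‖(Kwe.toCompletion p L w).symm o‖ ≤ ‖((p : ℕ) : Kwe p L w)‖ * 1 :=
          mul_le_mul_of_nonneg_left ho' (norm_nonneg _)
      _ < 1 / 2 := by rw [mul_one]; exact norm_natCast_prime_lt_half (K := Kwe p L w) hp2
  obtain ⟨P', hP'⟩ := exists_point_padicLogPointFiniteExt_eq_of_norm_lt_half (p := p) (L := L) (w := w) W ν _ hy
  exact ⟨P', by rw [hP']; rfl⟩

end Points

/-! ### §2 The sharp per-factor lattice bound -/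

variable (p : ℕ) [hp : Fact p.Prime]

attribute [local instance] fact_natCast_mem_primesEquiv_symm
-- the tree's `ℚ`-algebra structure on `ℚ_v` first (see `KimAtThreeDeepUpperExpStarFacts`)
attribute [local instance 100000] NumberField.Place.instAlgebraCompletion
attribute [local instance] valuativeRelPlace topologicalSpacePlace
attribute [local instance] isNonarchimedeanLocalField_place charZero_place
attribute [local instance] padicAlgebraPlace fact_not_isUnit_place isAdicComplete_place

set_option backward.isDefEq.respectTransparency false in
set_option maxHeartbeats 800000 in
/-- **The per-factor lattice bound at the SHARP radius, all places, exponent `v_p(m) + 1`** (`p` odd). For `W/ℚ`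
globally minimal, a local Néron line `d` at `v_p` with Prop-1.2.3 binders and `hdual` (read in `ℚ_p` through
`e_p⁻¹`), EVERY level `m = cycLevel p 0 r`, EVERY place `w₀ ∣ p` of `ℚ(ζ_m)` and every line datum `dw` of the
tower representation at `L_{w₀}` with Prop-1.2.3 binders and (RES_w): **`p^{v_p(m)+1} · exp*_{dw}(z) ∈ 𝒪_{w₀}` for
every `z ∈ H¹(L_{w₀}, T_pW)`** — so `p · exp*_{dw}(z) ∈ 𝒪_{w₀}` at every TAME level (`p ∤ m`, `L_{w₀}/ℚ_p`
unramified, `𝒪_{w₀}` trace-self-dual) and `p² · exp*_{dw}(z) ∈ 𝒪_{w₀}` at the wild ones (`p ∥ m`). Chain = w2-c3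
g8's: (S5b-tower) ⇒ ONE `e` with `range(exp*_{e•dw}) = (log_ω E(L_{w₀}))^∨` and `hdual(e•d)`; unit step
`e ∈ 𝒪_v`; points side §1 (`p𝒪_{w₀} ⊆ log_ω E(L_{w₀})`) ⇒ `Tr_{L_{w₀}/ℚ_v}(p a · 𝒪_{w₀}) ⊆ 𝒪_v`; w2-acc3's
inverse-different bound `p^{v_p(m)} 𝒪_{w₀}^∨ ⊆ 𝒪_{w₀}`; `exp*_{dw} = e · exp*_{e•dw}`. CONDITIONAL on the cite fact
(S5b-tower) only. [cite: Kato1993LNM1553, Ch. II §1.2.4, Thm. 1.4.1 (3)–(4)] [cite: BlochKato1990, §3 Prop. 3.8, Ex. 3.11]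
[cite: SilvermanAEC2009, Thm. IV.6.4 (b), VII.6.3] [cite: CasselsFrohlichANT1967, Ch. II §10 Theorem (10.2)] -/
theorem pow_padicValNat_succ_mul_expStarOmegaHom_mem_of_facts (hp2 : p ≠ 2)
    (hT₂ : exists_smul_range_expStarCoord_tower_iff_trace_log)
    (W : WeierstrassCurve ℚ) [W.IsElliptic] [W.IsGloballyMinimal]
    (d : LocalNeronLineAt W p ((primesEquiv (R := 𝓞 ℚ)).symm ⟨p, hp.out⟩))
    (hinj : (bdRPeriodRingData (valuation_place_lt_one p ((primesEquiv (R := 𝓞 ℚ)).symm ⟨p, hp.out⟩))).CupLogInjective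
      (logCyclotomic p) (localRationalTateRep W p (galRestrictPlace ((primesEquiv (R := 𝓞 ℚ)).symm ⟨p, hp.out⟩))))
    (hex : ∀ z : contOneCocycles (localRationalTateRep W p (galRestrictPlace ((primesEquiv (R := 𝓞 ℚ)).symm ⟨p, hp.out⟩))).toTopRep,
      (bdRPeriodRingData (valuation_place_lt_one p ((primesEquiv (R := 𝓞 ℚ)).symm ⟨p, hp.out⟩))).HasDualExp (logCyclotomic p)
        (localRationalTateRep W p (galRestrictPlace ((primesEquiv (R := 𝓞 ℚ)).symm ⟨p, hp.out⟩))) fun σ => z.1 σ)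
    (hdual : ∀ a : ℚ_[p], (∃ y, expStarOmegaPadicAt d hinj hex
        (((Padic.adicCompletionEquiv (𝓞 ℚ) ⟨p, hp.out⟩).symm : (((primesEquiv (R := 𝓞 ℚ)).symm ⟨p, hp.out⟩).adicCompletion ℚ) →+* ℚ_[p])) y = a) ↔
      ∀ Q : (W.baseChange ℚ_[p]).toAffine.Point, ‖a * padicLog (W.baseChange ℚ_[p]) Q‖ ≤ 1)
    (r : Finset (HeightOneSpectrum (𝓞 ℚ)))
    (w₀ : ((primesEquiv (R := 𝓞 ℚ)).symm ⟨p, hp.out⟩).Extension (𝓞 (CyclotomicField (cycLevel p 0 r) ℚ))) :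
    letI := LocalField.charZero_adicCompletion w₀.1
    letI := LocalField.adicCompletionPadicAlgebra w₀.1 p (Kw.prime_mem_asIdeal w₀)
    haveI : Fact (¬ IsUnit ((p : ℕ) : integerC (w₀.1.adicCompletion (CyclotomicField (cycLevel p 0 r) ℚ)))) := ⟨not_isUnit_natCast_integerC (LocalField.valuation_adicCompletion_natCast_lt_one w₀.1 p (Kw.prime_mem_asIdeal w₀))⟩
    haveI := isAdicComplete_integerC_natCast (LocalField.valuation_adicCompletion_natCast_lt_one w₀.1 p (Kw.prime_mem_asIdeal w₀))
    ∀ (dw : LocalNeronLine W (LocalField.valuation_adicCompletion_natCast_lt_one w₀.1 p (Kw.prime_mem_asIdeal w₀)) ((galRestrictPlace ((primesEquiv (R := 𝓞 ℚ)).symm ⟨p, hp.out⟩)).comp (absGaloisRestrict (((primesEquiv (R := 𝓞 ℚ)).symm ⟨p, hp.out⟩).adicCompletion ℚ) (w₀.1.adicCompletion (CyclotomicField (cycLevel p 0 r) ℚ)))))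
      (hinjw : (bdRPeriodRingData (LocalField.valuation_adicCompletion_natCast_lt_one w₀.1 p (Kw.prime_mem_asIdeal w₀))).CupLogInjective (logCyclotomic p) (localRationalTateRep W p ((galRestrictPlace ((primesEquiv (R := 𝓞 ℚ)).symm ⟨p, hp.out⟩)).comp (absGaloisRestrict (((primesEquiv (R := 𝓞 ℚ)).symm ⟨p, hp.out⟩).adicCompletion ℚ) (w₀.1.adicCompletion (CyclotomicField (cycLevel p 0 r) ℚ))))))
      (hexw : ∀ z : contOneCocycles (localRationalTateRep W p ((galRestrictPlace ((primesEquiv (R := 𝓞 ℚ)).symm ⟨p, hp.out⟩)).comp (absGaloisRestrict (((primesEquiv (R := 𝓞 ℚ)).symm ⟨p, hp.out⟩).adicCompletion ℚ) (w₀.1.adicCompletion (CyclotomicField (cycLevel p 0 r) ℚ))))).toTopRep,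
        (bdRPeriodRingData (LocalField.valuation_adicCompletion_natCast_lt_one w₀.1 p (Kw.prime_mem_asIdeal w₀))).HasDualExp (logCyclotomic p) (localRationalTateRep W p ((galRestrictPlace ((primesEquiv (R := 𝓞 ℚ)).symm ⟨p, hp.out⟩)).comp (absGaloisRestrict (((primesEquiv (R := 𝓞 ℚ)).symm ⟨p, hp.out⟩).adicCompletion ℚ) (w₀.1.adicCompletion (CyclotomicField (cycLevel p 0 r) ℚ))))) fun σ => z.1 σ),
      (∀ h : (tateLocalRep W p (Sum.inr ((primesEquiv (R := 𝓞 ℚ)).symm ⟨p, hp.out⟩))).cohomology 1,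
        expStarOmegaHom (LocalField.valuation_adicCompletion_natCast_lt_one w₀.1 p (Kw.prime_mem_asIdeal w₀)) ((galRestrictPlace ((primesEquiv (R := 𝓞 ℚ)).symm ⟨p, hp.out⟩)).comp (absGaloisRestrict (((primesEquiv (R := 𝓞 ℚ)).symm ⟨p, hp.out⟩).adicCompletion ℚ) (w₀.1.adicCompletion (CyclotomicField (cycLevel p 0 r) ℚ)))) dw hinjw hexw
          (ContinuousRep.cohomologyRes (tateLocalRep W p (Sum.inr ((primesEquiv (R := 𝓞 ℚ)).symm ⟨p, hp.out⟩))) (absGaloisRestrict (((primesEquiv (R := 𝓞 ℚ)).symm ⟨p, hp.out⟩).adicCompletion ℚ) (w₀.1.adicCompletion (CyclotomicField (cycLevel p 0 r) ℚ))) 1 h) =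
        algebraMap (((primesEquiv (R := 𝓞 ℚ)).symm ⟨p, hp.out⟩).adicCompletion ℚ) (w₀.1.adicCompletion (CyclotomicField (cycLevel p 0 r) ℚ)) (expStarOmegaAt d h)) →
      ∀ z, ((p : ℕ) : (w₀.1.adicCompletion (CyclotomicField (cycLevel p 0 r) ℚ))) ^ (padicValNat p (cycLevel p 0 r) + 1) * expStarOmegaHom (LocalField.valuation_adicCompletion_natCast_lt_one w₀.1 p (Kw.prime_mem_asIdeal w₀)) ((galRestrictPlace ((primesEquiv (R := 𝓞 ℚ)).symm ⟨p, hp.out⟩)).comp (absGaloisRestrict (((primesEquiv (R := 𝓞 ℚ)).symm ⟨p, hp.out⟩).adicCompletion ℚ) (w₀.1.adicCompletion (CyclotomicField (cycLevel p 0 r) ℚ)))) dw hinjw hexw z ∈ (w₀.1.adicCompletionIntegers (CyclotomicField (cycLevel p 0 r) ℚ)) := by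
  intro dw hinjw hexw hres z
  letI := LocalField.charZero_adicCompletion w₀.1
  letI := LocalField.adicCompletionPadicAlgebra w₀.1 p (Kw.prime_mem_asIdeal w₀)
  haveI : Fact (¬ IsUnit ((p : ℕ) : integerC (w₀.1.adicCompletion (CyclotomicField (cycLevel p 0 r) ℚ)))) := ⟨not_isUnit_natCast_integerC (LocalField.valuation_adicCompletion_natCast_lt_one w₀.1 p (Kw.prime_mem_asIdeal w₀))⟩
  haveI := isAdicComplete_integerC_natCast (LocalField.valuation_adicCompletion_natCast_lt_one w₀.1 p (Kw.prime_mem_asIdeal w₀))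
  -- `Place.Completion (inr v₀)` is `ℚ_{v₀}` by `rfl`: read the packet's algebra structure on it
  letI instEF : Algebra (NumberField.Place.Completion (K := ℚ) (Sum.inr ((primesEquiv (R := 𝓞 ℚ)).symm ⟨p, hp.out⟩))) (w₀.1.adicCompletion (CyclotomicField (cycLevel p 0 r) ℚ)) :=
    inferInstanceAs (Algebra (((primesEquiv (R := 𝓞 ℚ)).symm ⟨p, hp.out⟩).adicCompletion ℚ) (w₀.1.adicCompletion (CyclotomicField (cycLevel p 0 r) ℚ)))
  -- a compatible `ℝ≥0`-valuation on `L_{w₀}` (the base-`p^{1/e}` norm of the synonym `Kwe`) and integrality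
  haveI hνc := Kwe.compatible_normValuation (p := p) (L := (CyclotomicField (cycLevel p 0 r) ℚ)) (w := w₀)
  haveI : (W.baseChange (w₀.1.adicCompletion (CyclotomicField (cycLevel p 0 r) ℚ))).IsIntegral
      ((NormedField.valuation : Valuation (Kwe p (CyclotomicField (cycLevel p 0 r) ℚ) w₀) ℝ≥0).comap
        (Kwe.toCompletion p (CyclotomicField (cycLevel p 0 r) ℚ) w₀).symm.toRingHom).integer :=
    Kw.isIntegral_baseChange_of_isGloballyMinimal _ W
  -- (S5b-tower): ONE rescaling `e`
  obtain ⟨e, he, hde, hrange⟩ := exists_smul_ranges_of_facts W p ((primesEquiv (R := 𝓞 ℚ)).symm ⟨p, hp.out⟩) (LocalField.valuation_adicCompletion_natCast_lt_one w₀.1 p (Kw.prime_mem_asIdeal w₀)) hT₂ d hinj hex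
    ((NormedField.valuation : Valuation (Kwe p (CyclotomicField (cycLevel p 0 r) ℚ) w₀) ℝ≥0).comap (Kwe.toCompletion p (CyclotomicField (cycLevel p 0 r) ℚ) w₀).symm.toRingHom)
    dw hinjw hexw hres (((Padic.adicCompletionEquiv (𝓞 ℚ) ⟨p, hp.out⟩).symm : (((primesEquiv (R := 𝓞 ℚ)).symm ⟨p, hp.out⟩).adicCompletion ℚ) →+* ℚ_[p]))
  -- the unit step: `e ∈ 𝒪_v`
  obtain ⟨heO, -⟩ := mem_integers_of_hdual_smul W p ((primesEquiv (R := 𝓞 ℚ)).symm ⟨p, hp.out⟩) d hinj hex _ hdual he hde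
  have hE0 : algebraMap (((primesEquiv (R := 𝓞 ℚ)).symm ⟨p, hp.out⟩).adicCompletion ℚ) (w₀.1.adicCompletion (CyclotomicField (cycLevel p 0 r) ℚ)) e ≠ 0 := (map_ne_zero _).mpr he
  have hEO : algebraMap (((primesEquiv (R := 𝓞 ℚ)).symm ⟨p, hp.out⟩).adicCompletion ℚ) (w₀.1.adicCompletion (CyclotomicField (cycLevel p 0 r) ℚ)) e ∈ (w₀.1.adicCompletionIntegers (CyclotomicField (cycLevel p 0 r) ℚ)) :=
    w₀.adicCompletionSemialgHom_image_adicCompletionIntegers ℚ (CyclotomicField (cycLevel p 0 r) ℚ) ⟨e, heO, rfl⟩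
  -- `exp*_{dw} z = E · a'` with `a' := exp*_{E•dw} z` in the trace dual of `log_ω E(L_{w₀})`
  have haa' : expStarOmegaHom (LocalField.valuation_adicCompletion_natCast_lt_one w₀.1 p (Kw.prime_mem_asIdeal w₀)) ((galRestrictPlace ((primesEquiv (R := 𝓞 ℚ)).symm ⟨p, hp.out⟩)).comp (absGaloisRestrict (((primesEquiv (R := 𝓞 ℚ)).symm ⟨p, hp.out⟩).adicCompletion ℚ) (w₀.1.adicCompletion (CyclotomicField (cycLevel p 0 r) ℚ)))) dw hinjw hexw z = algebraMap (((primesEquiv (R := 𝓞 ℚ)).symm ⟨p, hp.out⟩).adicCompletion ℚ) (w₀.1.adicCompletion (CyclotomicField (cycLevel p 0 r) ℚ)) e *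
      expStarOmegaHom (LocalField.valuation_adicCompletion_natCast_lt_one w₀.1 p (Kw.prime_mem_asIdeal w₀)) ((galRestrictPlace ((primesEquiv (R := 𝓞 ℚ)).symm ⟨p, hp.out⟩)).comp (absGaloisRestrict (((primesEquiv (R := 𝓞 ℚ)).symm ⟨p, hp.out⟩).adicCompletion ℚ) (w₀.1.adicCompletion (CyclotomicField (cycLevel p 0 r) ℚ)))) (dw.smul (algebraMap (((primesEquiv (R := 𝓞 ℚ)).symm ⟨p, hp.out⟩).adicCompletion ℚ) (w₀.1.adicCompletion (CyclotomicField (cycLevel p 0 r) ℚ)) e) ((map_ne_zero (algebraMap (((primesEquiv (R := 𝓞 ℚ)).symm ⟨p, hp.out⟩).adicCompletion ℚ) (w₀.1.adicCompletion (CyclotomicField (cycLevel p 0 r) ℚ)))).mpr he))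
        hinjw hexw z := by
    rw [expStarOmegaHom_apply, expStarOmegaHom_apply, expStarOmega_smul, ← mul_assoc, mul_inv_cancel₀ hE0, one_mul]
  have hdual' := (hrange (expStarOmegaHom (LocalField.valuation_adicCompletion_natCast_lt_one w₀.1 p (Kw.prime_mem_asIdeal w₀)) ((galRestrictPlace ((primesEquiv (R := 𝓞 ℚ)).symm ⟨p, hp.out⟩)).comp (absGaloisRestrict (((primesEquiv (R := 𝓞 ℚ)).symm ⟨p, hp.out⟩).adicCompletion ℚ) (w₀.1.adicCompletion (CyclotomicField (cycLevel p 0 r) ℚ))))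
      (dw.smul (algebraMap (((primesEquiv (R := 𝓞 ℚ)).symm ⟨p, hp.out⟩).adicCompletion ℚ) (w₀.1.adicCompletion (CyclotomicField (cycLevel p 0 r) ℚ)) e) ((map_ne_zero (algebraMap (((primesEquiv (R := 𝓞 ℚ)).symm ⟨p, hp.out⟩).adicCompletion ℚ) (w₀.1.adicCompletion (CyclotomicField (cycLevel p 0 r) ℚ)))).mpr he)) hinjw hexw z)).mp ⟨z, rfl⟩
  -- points (SHARP, `p` odd): `p 𝒪_{w₀} ⊆ log_ω E(L_{w₀})`, so `Tr(p a' · o) ∈ 𝒪_v` for every `o ∈ 𝒪_{w₀}`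
  have htr : ∀ o ∈ (w₀.1.adicCompletionIntegers (CyclotomicField (cycLevel p 0 r) ℚ)),
      Algebra.trace (((primesEquiv (R := 𝓞 ℚ)).symm ⟨p, hp.out⟩).adicCompletion ℚ) (w₀.1.adicCompletion (CyclotomicField (cycLevel p 0 r) ℚ)) ((((p : ℕ) : (w₀.1.adicCompletion (CyclotomicField (cycLevel p 0 r) ℚ))) *
        expStarOmegaHom (LocalField.valuation_adicCompletion_natCast_lt_one w₀.1 p (Kw.prime_mem_asIdeal w₀)) ((galRestrictPlace ((primesEquiv (R := 𝓞 ℚ)).symm ⟨p, hp.out⟩)).comp (absGaloisRestrict (((primesEquiv (R := 𝓞 ℚ)).symm ⟨p, hp.out⟩).adicCompletion ℚ) (w₀.1.adicCompletion (CyclotomicField (cycLevel p 0 r) ℚ)))) (dw.smul (algebraMap (((primesEquiv (R := 𝓞 ℚ)).symm ⟨p, hp.out⟩).adicCompletion ℚ) (w₀.1.adicCompletion (CyclotomicField (cycLevel p 0 r) ℚ)) e) ((map_ne_zero (algebraMap (((primesEquiv (R := 𝓞 ℚ)).symm ⟨p, hp.out⟩).adicCompletion ℚ) (w₀.1.adicCompletion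 (CyclotomicField (cycLevel p 0 r) ℚ)))).mpr he))
          hinjw hexw z) * o) ∈ ((primesEquiv (R := 𝓞 ℚ)).symm ⟨p, hp.out⟩).adicCompletionIntegers ℚ := by
    intro o ho
    obtain ⟨P', hP'⟩ := exists_point_padicLogPointFiniteExt_eq_prime_mul (p := p) (L := (CyclotomicField (cycLevel p 0 r) ℚ)) (w := w₀) W hp2
      ((NormedField.valuation : Valuation (Kwe p (CyclotomicField (cycLevel p 0 r) ℚ) w₀) ℝ≥0).comap (Kwe.toCompletion p (CyclotomicField (cycLevel p 0 r) ℚ) w₀).symm.toRingHom) o ho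
    have h1 := hdual' P'
    rw [hP', ← mul_assoc, mul_comm (expStarOmegaHom _ _ _ _ _ _) (((p : ℕ) : (w₀.1.adicCompletion (CyclotomicField (cycLevel p 0 r) ℚ)))),
      Kw.trace_adicCompletionPadicAlgebra_eq w₀ (Kw.prime_mem_asIdeal w₀)] at h1
    exact mem_adicCompletionIntegers_of_norm_symm_le_one p _ h1
  -- w2-acc3's inverse-different bound: `p^{v_p(m)} · p a' ∈ 𝒪_{w₀}`, i.e. `p^{v_p(m)+1} a' ∈ 𝒪_{w₀}`
  haveI := HeightOneSpectrum.Extension.fintype (𝓞 ℚ) ℚ (CyclotomicField (cycLevel p 0 r) ℚ) (𝓞 (CyclotomicField (cycLevel p 0 r) ℚ)) ((primesEquiv (R := 𝓞 ℚ)).symm ⟨p, hp.out⟩)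
  have hmem := pow_padicValNat_mul_mem_adicCompletionIntegers_of_forall_trace_mul_mem (cycLevel p 0 r) p w₀ _ htr
  have h3 : ((p : ℕ) : (w₀.1.adicCompletion (CyclotomicField (cycLevel p 0 r) ℚ))) ^ (padicValNat p (cycLevel p 0 r) + 1) *
      expStarOmegaHom (LocalField.valuation_adicCompletion_natCast_lt_one w₀.1 p (Kw.prime_mem_asIdeal w₀)) ((galRestrictPlace ((primesEquiv (R := 𝓞 ℚ)).symm ⟨p, hp.out⟩)).comp (absGaloisRestrict (((primesEquiv (R := 𝓞 ℚ)).symm ⟨p, hp.out⟩).adicCompletion ℚ) (w₀.1.adicCompletion (CyclotomicField (cycLevel p 0 r) ℚ)))) (dw.smul (algebraMap (((primesEquiv (R := 𝓞 ℚ)).symm ⟨p, hp.out⟩).adicCompletion ℚ) (w₀.1.adicCompletion (CyclotomicField (cycLevel p 0 r) ℚ)) e) ((map_ne_zero (algebraMap (((primesEquiv (R := 𝓞 ℚ)).symm ⟨p, hp.out⟩).adicCompletion ℚ) (w₀.1.adicCompletion (CyclotomicField (cycLevel p 0 r) ℚ)))).mpr he))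
        hinjw hexw z ∈ (w₀.1.adicCompletionIntegers (CyclotomicField (cycLevel p 0 r) ℚ)) := by
    rwa [← mul_assoc, ← pow_succ] at hmem
  rw [haa', mul_left_comm]
  exact mul_mem hEO h3

set_option backward.isDefEq.respectTransparency false in
set_option maxHeartbeats 400000 in
/-- **`p = 3`, TAME level (`3 ∤ m`): `3 · exp*_{dw}(z) ∈ 𝒪_{w₀}`** at every place `w₀ ∣ 3` of `ℚ(ζ_m)`, for every
(RES_w)-compatible line datum over an `hdual`-normalised Néron line — the exponent `b = 1` that support item 20396
(C1ₑₓ¹ᵘ) and the tame weight `θ_r = 1` of this seat's (C1ₑₓʷ) display, now a CONSEQUENCE of (S5b-tower) for the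
DEFINED dual exponential (any reduction type at `3`). [cite: Kato1993LNM1553, Ch. II Thm. 1.4.1 (3)–(4)]
[cite: BlochKato1990, §3 Prop. 3.8, Ex. 3.11] [cite: SilvermanAEC2009, Thm. IV.6.4 (b)] [cite: Kim2022StructureSelmer, §3.4.1] -/
theorem three_mul_expStarOmegaHom_mem_of_facts_of_not_dvd (hT₂ : exists_smul_range_expStarCoord_tower_iff_trace_log)
    (W : WeierstrassCurve ℚ) [W.IsElliptic] [W.IsGloballyMinimal]
    (d : LocalNeronLineAt W 3 ((primesEquiv (R := 𝓞 ℚ)).symm ⟨3, Fact.out⟩))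
    (hinj : (bdRPeriodRingData (valuation_place_lt_one 3 ((primesEquiv (R := 𝓞 ℚ)).symm ⟨3, Fact.out⟩))).CupLogInjective
      (logCyclotomic 3) (localRationalTateRep W 3 (galRestrictPlace ((primesEquiv (R := 𝓞 ℚ)).symm ⟨3, Fact.out⟩))))
    (hex : ∀ z : contOneCocycles (localRationalTateRep W 3 (galRestrictPlace ((primesEquiv (R := 𝓞 ℚ)).symm ⟨3, Fact.out⟩))).toTopRep,
      (bdRPeriodRingData (valuation_place_lt_one 3 ((primesEquiv (R := 𝓞 ℚ)).symm ⟨3, Fact.out⟩))).HasDualExp (logCyclotomic 3)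
        (localRationalTateRep W 3 (galRestrictPlace ((primesEquiv (R := 𝓞 ℚ)).symm ⟨3, Fact.out⟩))) fun σ => z.1 σ)
    (hdual : ∀ a : ℚ_[3], (∃ y, expStarOmegaPadicAt d hinj hex
        (((Padic.adicCompletionEquiv (𝓞 ℚ) ⟨3, Fact.out⟩).symm : (((primesEquiv (R := 𝓞 ℚ)).symm ⟨3, Fact.out⟩).adicCompletion ℚ) →+* ℚ_[3])) y = a) ↔
      ∀ Q : (W.baseChange ℚ_[3]).toAffine.Point, ‖a * padicLog (W.baseChange ℚ_[3]) Q‖ ≤ 1)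
    (r : Finset (HeightOneSpectrum (𝓞 ℚ))) (hr : ¬ 3 ∣ cycLevel 3 0 r)
    (w₀ : ((primesEquiv (R := 𝓞 ℚ)).symm ⟨3, Fact.out⟩).Extension (𝓞 (CyclotomicField (cycLevel 3 0 r) ℚ))) :
    letI := LocalField.charZero_adicCompletion w₀.1
    letI := LocalField.adicCompletionPadicAlgebra w₀.1 3 (Kw.prime_mem_asIdeal w₀)
    haveI : Fact (¬ IsUnit ((3 : ℕ) : integerC (w₀.1.adicCompletion (CyclotomicField (cycLevel 3 0 r) ℚ)))) := ⟨not_isUnit_natCast_integerC (LocalField.valuation_adicCompletion_natCast_lt_one w₀.1 3 (Kw.prime_mem_asIdeal w₀))⟩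
    haveI := isAdicComplete_integerC_natCast (LocalField.valuation_adicCompletion_natCast_lt_one w₀.1 3 (Kw.prime_mem_asIdeal w₀))
    ∀ (dw : LocalNeronLine W (LocalField.valuation_adicCompletion_natCast_lt_one w₀.1 3 (Kw.prime_mem_asIdeal w₀)) ((galRestrictPlace ((primesEquiv (R := 𝓞 ℚ)).symm ⟨3, Fact.out⟩)).comp (absGaloisRestrict (((primesEquiv (R := 𝓞 ℚ)).symm ⟨3, Fact.out⟩).adicCompletion ℚ) (w₀.1.adicCompletion (CyclotomicField (cycLevel 3 0 r) ℚ)))))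
      (hinjw : (bdRPeriodRingData (LocalField.valuation_adicCompletion_natCast_lt_one w₀.1 3 (Kw.prime_mem_asIdeal w₀))).CupLogInjective (logCyclotomic 3) (localRationalTateRep W 3 ((galRestrictPlace ((primesEquiv (R := 𝓞 ℚ)).symm ⟨3, Fact.out⟩)).comp (absGaloisRestrict (((primesEquiv (R := 𝓞 ℚ)).symm ⟨3, Fact.out⟩).adicCompletion ℚ) (w₀.1.adicCompletion (CyclotomicField (cycLevel 3 0 r) ℚ))))))
      (hexw : ∀ z : contOneCocycles (localRationalTateRep W 3 ((galRestrictPlace ((primesEquiv (R := 𝓞 ℚ)).symm ⟨3, Fact.out⟩)).comp (absGaloisRestrict (((primesEquiv (R := 𝓞 ℚ)).symm ⟨3, Fact.out⟩).adicCompletion ℚ) (w₀.1.adicCompletion (CyclotomicField (cycLevel 3 0 r) ℚ))))).toTopRep,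
        (bdRPeriodRingData (LocalField.valuation_adicCompletion_natCast_lt_one w₀.1 3 (Kw.prime_mem_asIdeal w₀))).HasDualExp (logCyclotomic 3) (localRationalTateRep W 3 ((galRestrictPlace ((primesEquiv (R := 𝓞 ℚ)).symm ⟨3, Fact.out⟩)).comp (absGaloisRestrict (((primesEquiv (R := 𝓞 ℚ)).symm ⟨3, Fact.out⟩).adicCompletion ℚ) (w₀.1.adicCompletion (CyclotomicField (cycLevel 3 0 r) ℚ))))) fun σ => z.1 σ),
      (∀ h : (tateLocalRep W 3 (Sum.inr ((primesEquiv (R := 𝓞 ℚ)).symm ⟨3, Fact.out⟩))).cohomology 1,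
        expStarOmegaHom (LocalField.valuation_adicCompletion_natCast_lt_one w₀.1 3 (Kw.prime_mem_asIdeal w₀)) ((galRestrictPlace ((primesEquiv (R := 𝓞 ℚ)).symm ⟨3, Fact.out⟩)).comp (absGaloisRestrict (((primesEquiv (R := 𝓞 ℚ)).symm ⟨3, Fact.out⟩).adicCompletion ℚ) (w₀.1.adicCompletion (CyclotomicField (cycLevel 3 0 r) ℚ)))) dw hinjw hexw
          (ContinuousRep.cohomologyRes (tateLocalRep W 3 (Sum.inr ((primesEquiv (R := 𝓞 ℚ)).symm ⟨3, Fact.out⟩))) (absGaloisRestrict (((primesEquiv (R := 𝓞 ℚ)).symm ⟨3, Fact.out⟩).adicCompletion ℚ) (w₀.1.adicCompletion (CyclotomicField (cycLevel 3 0 r) ℚ))) 1 h) =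
        algebraMap (((primesEquiv (R := 𝓞 ℚ)).symm ⟨3, Fact.out⟩).adicCompletion ℚ) (w₀.1.adicCompletion (CyclotomicField (cycLevel 3 0 r) ℚ)) (expStarOmegaAt d h)) →
      ∀ z, ((3 : ℕ) : (w₀.1.adicCompletion (CyclotomicField (cycLevel 3 0 r) ℚ))) * expStarOmegaHom (LocalField.valuation_adicCompletion_natCast_lt_one w₀.1 3 (Kw.prime_mem_asIdeal w₀)) ((galRestrictPlace ((primesEquiv (R := 𝓞 ℚ)).symm ⟨3, Fact.out⟩)).comp (absGaloisRestrict (((primesEquiv (R := 𝓞 ℚ)).symm ⟨3, Fact.out⟩).adicCompletion ℚ) (w₀.1.adicCompletion (CyclotomicField (cycLevel 3 0 r) ℚ)))) dw hinjw hexw z ∈ (w₀.1.adicCompletionIntegers (CyclotomicField (cycLevel 3 0 r) ℚ)) := by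
  intro dw hinjw hexw hres z
  have h0 : padicValNat 3 (cycLevel 3 0 r) = 0 := padicValNat.eq_zero_of_not_dvd hr
  have h := pow_padicValNat_succ_mul_expStarOmegaHom_mem_of_facts 3 (by norm_num) hT₂ W d hinj hex hdual r w₀ dw hinjw hexw hres z
  rwa [h0, zero_add, pow_one] at h

end Summit.BirchSwinnertonDyer.BirchSwinnertonDyer.Theorems.KimAtThreeShallowEqDeepSharpLattice

end
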